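import Summits.ResolutionOfSingularities.ResolutionOfSingularities.Theorems.FrobeniusClosingNoPeriodicIsolatedAtomOfClassicalRegimes
import Summits.ResolutionOfSingularities.ResolutionOfSingularities.Theorems.WildConesClassicalRegimes

/-!
# Crux `NoPeriodicIsolatedAtom` (stmt-ResolutionOfSingularities-16344, route `FrobeniusClosing`) — PROVED

THE CERTIFICATE of route `FrobeniusClosing`: over fields algebraic over `𝔽_p`, no chain
`c_0, …, c_r` (`r ≥ 1`) of the point-blow-up dynamics of a height-one atom `z^p = a(u₁, …, uₙ)` all of
whose states are ISOLATED of multiplicity `p` returns to a pair-isomorphic state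
(`(κ⟦u⟧, [a_r]) ≅ (κ⟦u⟧, [a_0])`) — Hauser–Perlega's missing "forced cycle" does not exist for
height-one atoms.

Assembly (line `ridge_rank`, Theorems-side, all edges landed): a periodic isolated chain unwinds to an
eternal isolated multiplicity-`p` chain over the same field (successor transport under pair
isomorphisms, `…NoPeriodicIsolatedAtomUnwindOfTransport`); for `p` odd and `n ≥ 3` the cone exit
lemma (`WildConesConeExit.ConeExit_proof`) puts every state on the ridge with invariance rank one and
`NarrowRunsDie_proof` excludes such runs (`…NoPeriodicIsolatedAtomOfEngine`,
`…OfClassicalRegimes`: `ClassicalRegimes → NoPeriodicIsolatedAtom`, p172077); the classical regimes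
`n ≤ 2 ∨ p = 2` are `WildCones.ClassicalRegimes_proof` (`Theorems/WildConesClassicalRegimes.lean`: the
Milnor number is a strict Lyapunov function — curve drop, surface drop via Huneke–Swanson / Max
Noether, and the characteristic-two hyperbolic-pair descent).

Everything here is OURS (campaign res-hironaka, rung L, slot W4.1, chain w41); it replaces the role of
no printed item and is NOT a statement of Hironaka's manuscript.
-/

noncomputable section

-- single-problem summit: the doubled namespace component is forced by the tree layout
set_option linter.dupNamespace false

namespace Summit.ResolutionOfSingularities.ResolutionOfSingularities.Theorems.FrobeniusClosing

open Summit.ResolutionOfSingularities.ResolutionOfSingularities.Theses.FrobeniusClosing (NoPeriodicIsolatedAtom)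

/-- **THE CRUX `FrobeniusClosing.NoPeriodicIsolatedAtom` (stmt-ResolutionOfSingularities-16344), PROVED**:
no periodic isolated multiplicity-`p` chain of the point-blow-up dynamics of a height-one atom over a
field algebraic over `𝔽_p`. `noPeriodicIsolatedAtom_of_classicalRegimes` (p172077) applied to
`WildCones.ClassicalRegimes_proof`. OURS; NOT a statement of Hironaka's manuscript.
[cite: HauserPerlega2019, §1 p. 3 and §5] -/
theorem noPeriodicIsolatedAtom_proof : NoPeriodicIsolatedAtom :=
  noPeriodicIsolatedAtom_of_classicalRegimes
    Summit.ResolutionOfSingularities.ResolutionOfSingularities.Theorems.WildCones.ClassicalRegimes_proof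

end Summit.ResolutionOfSingularities.ResolutionOfSingularities.Theorems.FrobeniusClosing

end
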